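import Summits.NavierStokesRegularity.NavierStokesRegularity.Theorems.ScalingDefectPeepholeDoorTubeAssembly
import Literature.Analysis.FluidPDE.NSLocalAnalyticityRadiusSupBound
import Literature.Analysis.FluidPDE.NSLocalAnalyticityRadiusScalingTools
import Literature.Analysis.FluidPDE.ClassicalSolutionRegionRescale
import Literature.Analysis.FluidPDE.PineauVicolOneSliceRegularityHolds
import Literature.Analysis.FluidPDE.ChaeAsymptoticallySelfSimilarLocalLeray

/-!
# ScalingDefectPeepholeDoorTubeWindow — door S30 «ScalingDefectPeepholeDoor» v2 (nsreg-p1 g24 ROUND-28 v2 6cf1a9889313ec10),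
# plate P2 = K1ω `VortexDefectTubeBound`, part T3: THE WINDOW-FIELD TUBE EXTENSION FROM BGK, MODULO THE SCALED SLICE PRESSURE BOUND

The NS half of K1ω.  `windowExtension_of_scaledSlicePressure`: GIVEN the class-uniform pressure bound at the similarity scale
«`‖p(t)‖_{L²(B(0, R√(−t)))} ≤ C_P(C_u, R) (−t)^{−1/4}` for late `t`» (Pineau–Vicol 2026 proof of Prop. 9.5, p. 33, `p = p_loc + h` with
the `C_p`-part invisible at the similarity scale; the one input of plate P2 still to be typed — a twin of the tree's slice bound
`exists_forall_lintegral_ball_pressure_rpow_le` at the exponent `2`), every Pineau–Vicol-class solution has, at every late time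
`t̄`, a window field `√(−t̄) u(t̄, √(−t̄)·)` extending holomorphically to `localComplexTube 0 (A+1) δ₀` with a bound `K₀`,
`δ₀, K₀` depending on `(C_u, A)` only — the hypothesis `hWin` of `vortexDefectTubeBound_of_windowExtension` (part T4).

Route (unit scale, no `c`-dependent constants): zoom AND shift the solution, `v(s, y) = c u((1+κ)t̄ + c²s, c y)`, `c = √(−t̄)`
(tree `IsClassicalNSSolutionOnRegion.nsRescale_translate_of_isOpen`); on `s ∈ (0, Lκ)`, `y ∈ B(0, 4(A+1))` the physical time `t`
has `−t ∈ [c²/2, 2c²]`, so Type I gives `|v| ≤ 2C_u`, the gradient envelope (`exists_forall_fderiv_le_of_typeI_of_bounds`) gives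
`|∇v| ≤ 2K`, and the pressure hypothesis gives `‖c²p(t, c·)‖_{L²(B(0,4(A+1)))} ≤ 2C_P` (`eLpNorm_smul_comp_space_affine_restrict_ball`);
Bradshaw–Grujić–Kukavica with the bound of its scheme (`bradshawGrujicKukavica2015_local_analyticity_radius_supBound`, `q = 4`,
`r = 9`, interval length `Lκ`, `L = C+1`) at the elapsed time `κ = κ(C_u, A)` yields the extension of `v(κ, ·) = √(−t̄)u(t̄, √(−t̄)·)`
on `localComplexTube 0 (A+1) (√κ/(4C₀))` with bound `C₁/√κ`.

* `vortexDefectTubeBound_of_scaledSlicePressure` — K1ω BY NAME modulo that one pressure input (T3 ∘ T4).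

Door S30 is a regularity CRITERION inside a HYPOTHETICAL local Type-I blow-up (item 0056 `NoTypeII` stays OPEN); nothing here bears on
NS regularity itself.
-/

noncomputable section

set_option linter.dupNamespace false

namespace Summit.NavierStokesRegularity.NavierStokesRegularity.Theorems.ScalingDefectPeepholeDoor

open MeasureTheory Set Function Filter Metric TopologicalSpace Complex
open scoped Topology ENNReal NNReal ContDiff Laplacian
open Literature.Analysis Literature.Analysis.FluidPDE Literature.Analysis.Complex
open Literature.Analysis.FunctionSpaces.EuclideanSpace (complexify norm_complexify complexify_apply)
open Summit.NavierStokesRegularity.NavierStokesRegularity.Theorems.StableStrataDoorDefs (physWindowField)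

-- nested operator types
set_option maxSynthPendingDepth 3

/-! ## The window-field extension from BGK at unit scale (helpers `eLpNorm_restrict_le_of_forall_norm_le`, `zoom_pressure_level_le` in part T4) -/

set_option maxHeartbeats 3200000 in
/-- **The window-field tube extension, modulo the scaled slice pressure bound** (part T3 of K1ω): see the module docstring.
The hypothesis `hP` is the class-uniform `L²` pressure bound at the similarity scale (constant from `C_u, R`; lateness from `C_p`);
the conclusion is the hypothesis `hWin` of `vortexDefectTubeBound_of_windowExtension`. -/
theorem windowExtension_of_scaledSlicePressure
    (hP : ∀ Cu : ℝ, 0 < Cu → ∀ R : ℝ, 0 < R → ∃ CP : ℝ, 0 ≤ CP ∧ ∀ Cp : ℝ, 0 < Cp → ∃ TP : ℝ, 0 < TP ∧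
      ∀ (u : ℝ → EuclideanSpace ℝ (Fin 3) → EuclideanSpace ℝ (Fin 3)) (p : ℝ → EuclideanSpace ℝ (Fin 3) → ℝ),
        IsClassicalNSSolutionOnRegion
          (Ico (-1 : ℝ) 0 ×ˢ ball (0 : EuclideanSpace ℝ (Fin 3)) 1) 1 0 u p →
        (∀ t ∈ Ico (-1 : ℝ) 0, ∀ x ∈ ball (0 : EuclideanSpace ℝ (Fin 3)) 1,
          ‖u t x‖ ≤ Cu / (Real.sqrt (-t) + ‖x‖)) →
        (∀ t ∈ Ico (-1 : ℝ) 0, ∀ x : EuclideanSpace ℝ (Fin 3), 1 / 2 < ‖x‖ → ‖x‖ < 3 / 4 → |p t x| ≤ Cp) →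
        ∀ t ∈ Ioo (-TP) 0,
          eLpNorm (p t) 2 (volume.restrict (ball (0 : EuclideanSpace ℝ (Fin 3)) (R * Real.sqrt (-t)))) ≤
            ENNReal.ofReal (CP * (-t) ^ (-(1 / 4 : ℝ)))) :
    ∀ Cu : ℝ, 0 < Cu → ∀ A : ℝ, 1 ≤ A → ∃ δ₀ K₀ : ℝ, 0 < δ₀ ∧ 0 ≤ K₀ ∧ ∀ Cp : ℝ, 0 < Cp →
      ∃ T₁ : ℝ, 0 < T₁ ∧ T₁ ≤ 1 ∧
      ∀ (u : ℝ → EuclideanSpace ℝ (Fin 3) → EuclideanSpace ℝ (Fin 3)) (p : ℝ → EuclideanSpace ℝ (Fin 3) → ℝ),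
        IsClassicalNSSolutionOnRegion
          (Ico (-1 : ℝ) 0 ×ˢ ball (0 : EuclideanSpace ℝ (Fin 3)) 1) 1 0 u p →
        (∀ t ∈ Ico (-1 : ℝ) 0, ∀ x ∈ ball (0 : EuclideanSpace ℝ (Fin 3)) 1,
          ‖u t x‖ ≤ Cu / (Real.sqrt (-t) + ‖x‖)) →
        (∀ t ∈ Ico (-1 : ℝ) 0, ∀ x : EuclideanSpace ℝ (Fin 3), 1 / 2 < ‖x‖ → ‖x‖ < 3 / 4 → |p t x| ≤ Cp) →
        ∀ tb ∈ Ioo (-T₁) 0,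
          ∃ U : EuclideanSpace ℂ (Fin 3) → EuclideanSpace ℂ (Fin 3),
            DifferentiableOn ℂ U (localComplexTube (0 : EuclideanSpace ℝ (Fin 3)) (A + 1) δ₀) ∧
            (∀ z ∈ localComplexTube (0 : EuclideanSpace ℝ (Fin 3)) (A + 1) δ₀, ‖U z‖ ≤ K₀) ∧
            ∀ y ∈ ball (0 : EuclideanSpace ℝ (Fin 3)) (A + 1),
              U (complexify y) = complexify (physWindowField 0 0 u tb y) := by
  intro Cu hCu A hA
  set ρ : ℝ := A + 1 with hρ_def
  have hρ : 0 < ρ := by rw [hρ_def]; linarith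
  -- universal inputs
  obtain ⟨C₀, C, C₁, hC₀, hC, hC₁, hBGK⟩ := bradshawGrujicKukavica2015_local_analyticity_radius_supBound
  obtain ⟨K', hK'0, HK⟩ := exists_forall_fderiv_le_of_typeI_of_bounds Cu
  obtain ⟨CP, hCP, HP⟩ := hP Cu hCu (8 * ρ) (by positivity)
  -- unit-scale levels
  have hVfin : volume (ball (0 : EuclideanSpace ℝ (Fin 3)) (4 * ρ)) < ⊤ := measure_ball_lt_top
  set V : ℝ := (volume (ball (0 : EuclideanSpace ℝ (Fin 3)) (4 * ρ))).toReal with hV_def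
  have hV : 0 ≤ V := ENNReal.toReal_nonneg
  set Alv : ℝ := V ^ (1 / 4 : ℝ) * (2 * Cu) with hAlv_def
  set Blv : ℝ := Real.sqrt (2 * CP) with hBlv_def
  set Glv : ℝ := V ^ (1 / 4 : ℝ) * (4 * K') with hGlv_def
  have hAlv : 0 ≤ Alv := by positivity
  have hBlv : 0 ≤ Blv := Real.sqrt_nonneg _
  have hGlv : 0 ≤ Glv := by positivity
  set L : ℝ := C + 1 with hL_def
  have hL : 0 < L := by positivity
  set Mbar : ℝ := Alv + Blv + Glv with hMbar_def
  have hMbar : 0 ≤ Mbar := by positivity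
  have hV0 : 0 < V := by
    rw [hV_def]
    exact ENNReal.toReal_pos (measure_ball_pos volume _ (by positivity)).ne' hVfin.ne
  have hMbar0 : 0 < Mbar := by
    have : 0 < Alv := by rw [hAlv_def]; exact mul_pos (Real.rpow_pos_of_pos hV0 _) (by positivity)
    rw [hMbar_def]; linarith
  set X : ℝ := ((4 : ℝ) ^ 2 * (C * Mbar) ^ (2 * 4 / (4 - 3) : ℝ))⁻¹ with hX_def
  have hX : 0 < X := by
    rw [hX_def]; exact inv_pos.2 (mul_pos (by norm_num) (Real.rpow_pos_of_pos (by positivity) _))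
  -- the elapsed time `κ` (similarity units) and the outputs
  set κ : ℝ := min (1 / (2 * L)) (min (C⁻¹ * ρ ^ 2 / 2) (C⁻¹ * X / 2)) with hκ_def
  have hκ : 0 < κ := lt_min (by positivity) (lt_min (by positivity) (by positivity))
  have hκL : κ ≤ 1 / (2 * L) := min_le_left _ _
  have hκρ : κ ≤ C⁻¹ * ρ ^ 2 / 2 := (min_le_right _ _).trans (min_le_left _ _)
  have hκX : κ ≤ C⁻¹ * X / 2 := (min_le_right _ _).trans (min_le_right _ _)
  have hLκ : L * κ ≤ 1 / 2 := by
    calc L * κ ≤ L * (1 / (2 * L)) := mul_le_mul_of_nonneg_left hκL hL.le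
      _ = 1 / 2 := by field_simp
  have hCκ : C * κ ≤ 1 / 2 := le_trans (mul_le_mul_of_nonneg_right (by rw [hL_def]; linarith) hκ.le) hLκ
  have hκ1 : κ ≤ 1 := by
    have : 1 * κ ≤ L * κ := mul_le_mul_of_nonneg_right (by rw [hL_def]; linarith) hκ.le
    linarith
  refine ⟨Real.sqrt κ / (4 * C₀), C₁ / Real.sqrt κ, by positivity, by positivity, fun Cp hCp => ?_⟩
  -- class bounds and the lateness
  obtain ⟨TP, hTP, HP'⟩ := HP Cp hCp
  obtain ⟨Bp, HBp⟩ := exists_lintegral_pressure_rpow_threeHalves_le Cu Cp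
  set Tq : ℝ≥0∞ := ∫⁻ t in Ioo (-1 : ℝ) 0, ENNReal.ofReal ((-t) ^ (-(1 / 4 : ℝ))) with hTq
  set Xq : ℝ≥0∞ := ∫⁻ x in ball (0 : EuclideanSpace ℝ (Fin 3)) 1,
    ENNReal.ofReal (‖x‖ ^ (-(5 / 2 : ℝ))) with hXq
  set Bu : ℝ≥0∞ := ENNReal.ofReal (Cu ^ 3) * (Tq * Xq) with hBu
  have hBut : Bu < ⊤ := ENNReal.mul_lt_top ENNReal.ofReal_lt_top
    (ENNReal.mul_lt_top lintegral_Ioo_neg_rpow_quarter_lt_top lintegral_ball_norm_rpow_lt_top)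
  obtain ⟨c₁, hc₁, Hgrad⟩ := HK Bu Bp hBut ENNReal.coe_lt_top
  set T₁ : ℝ := min (1 / 4) (min (TP / 2) (min ((c₁ / (4 * ρ + 2)) ^ 2) ((1 / (8 * ρ)) ^ 2))) with hT₁_def
  have hT₁ : 0 < T₁ := lt_min (by norm_num) (lt_min (by positivity) (lt_min (by positivity) (by positivity)))
  refine ⟨T₁, hT₁, (min_le_left _ _).trans (by norm_num), fun u p hreg hI hPr tb htb => ?_⟩
  -- the scale `c = √(−t̄)` and its smallness
  have htb0 : tb < 0 := htb.2
  have hntb : 0 < -tb := by linarith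
  set c : ℝ := Real.sqrt (-tb) with hc_def
  have hc : 0 < c := Real.sqrt_pos.2 hntb
  have hc2 : c ^ 2 = -tb := Real.sq_sqrt hntb.le
  have hT₁le : ∀ {a : ℝ}, T₁ ≤ a → -tb < a := fun h => lt_of_lt_of_le (by linarith [htb.1]) h
  have hc2_4 : c ^ 2 < 1 / 4 := by rw [hc2]; exact hT₁le (min_le_left _ _)
  have hc2_TP : c ^ 2 < TP / 2 := by rw [hc2]; exact hT₁le ((min_le_right _ _).trans (min_le_left _ _))
  have hc_lt : ∀ {a : ℝ}, 0 < a → -tb < a ^ 2 → c < a := fun ha h => by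
    rw [hc_def, ← Real.sqrt_sq ha.le]; exact Real.sqrt_lt_sqrt hntb.le h
  have hc_c₁ : c < c₁ / (4 * ρ + 2) :=
    hc_lt (by positivity) (hT₁le ((min_le_right _ _).trans ((min_le_right _ _).trans (min_le_left _ _))))
  have hc_ρ : c < 1 / (8 * ρ) :=
    hc_lt (by positivity) (hT₁le ((min_le_right _ _).trans ((min_le_right _ _).trans (min_le_right _ _))))
  have hc1 : c ≤ 1 := by nlinarith
  have h4ρc : 4 * ρ * c < 1 := by
    have := mul_lt_mul_of_pos_left hc_ρ (by positivity : (0 : ℝ) < 8 * ρ)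
    rw [mul_one_div_cancel (by positivity)] at this; linarith
  -- the zoomed and shifted solution `v s y = c u(ts + c² s, c y)`, `ts = (1+κ) t̄`
  set ts : ℝ := (1 + κ) * tb with hts_def
  have hts1 : -1 < ts := by rw [hts_def]; nlinarith
  have hO : IsOpen (Ioo (-1 : ℝ) 0 ×ˢ ball (0 : EuclideanSpace ℝ (Fin 3)) 1) := isOpen_Ioo.prod isOpen_ball
  have hsolv := (hreg.mono_of_isOpen (prod_mono Ioo_subset_Ico_self Subset.rfl) hO).nsRescale_translate_of_isOpen
    hO hc ts 0
  set Ω' : Set (ℝ × EuclideanSpace ℝ (Fin 3)) :=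
    stAffine (c ^ 2) c ts 0 ⁻¹' (Ioo (-1 : ℝ) 0 ×ˢ ball (0 : EuclideanSpace ℝ (Fin 3)) 1) with hΩ'_def
  have hΩ'open : IsOpen Ω' := hO.preimage (continuous_stAffine _ _ _ _)
  set v : ℝ → EuclideanSpace ℝ (Fin 3) → EuclideanSpace ℝ (Fin 3) := c • stPull (c ^ 2) c ts 0 u with hv_def
  set q : ℝ → EuclideanSpace ℝ (Fin 3) → ℝ := c ^ 2 • stPull (c ^ 2) c ts 0 p with hq_def
  have hv_apply : ∀ s y, v s y = c • u (ts + c ^ 2 * s) (c • y) := fun s y => by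
    simp [hv_def, stPull_apply]
  have hq_apply : ∀ s y, q s y = c ^ 2 * p (ts + c ^ 2 * s) (c • y) := fun s y => by
    simp [hq_def, stPull_apply]
  -- the window in zoomed time: `s ∈ (0, Lκ)`; physical `t = ts + c² s` has `−t ∈ [c²/2, 2c²]`
  have hwin : ∀ s ∈ Ioo 0 (L * κ), -1 < ts + c ^ 2 * s ∧ ts + c ^ 2 * s < 0 ∧
      c ^ 2 / 2 ≤ -(ts + c ^ 2 * s) ∧ -(ts + c ^ 2 * s) ≤ 2 * c ^ 2 := by
    intro s hs
    have htb' : tb = -c ^ 2 := by linarith [hc2]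
    have h1 : -(ts + c ^ 2 * s) = c ^ 2 * (1 + κ - s) := by rw [hts_def, htb']; ring
    refine ⟨?_, ?_, ?_, ?_⟩
    · have : 0 < c ^ 2 * s := mul_pos (by positivity) hs.1
      linarith
    · rw [← neg_pos, h1]; exact mul_pos (by positivity) (by linarith [hs.2])
    · rw [h1]; nlinarith [hs.2, hLκ, sq_nonneg c]
    · rw [h1]; nlinarith [hs.1, hκ1, sq_nonneg c]
  -- the BGK cylinder lies in the zoomed region
  have hcyl : ∀ s ∈ Ioo 0 (L * κ), ∀ y ∈ ball (0 : EuclideanSpace ℝ (Fin 3)) (4 * ρ), (s, y) ∈ Ω' := by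
    intro s hs y hy
    obtain ⟨h1, h2, -, -⟩ := hwin s hs
    rw [hΩ'_def, mem_preimage, stAffine_apply]
    refine mk_mem_prod ⟨h1, h2⟩ ?_
    rw [zero_add, mem_ball_zero_iff, norm_smul, Real.norm_of_nonneg hc.le]
    rw [mem_ball_zero_iff] at hy
    calc c * ‖y‖ ≤ c * (4 * ρ) := mul_le_mul_of_nonneg_left hy.le hc.le
      _ = 4 * ρ * c := by ring
      _ < 1 := h4ρc
  have hcylsub : Ioo 0 (L * κ) ×ˢ ball (0 : EuclideanSpace ℝ (Fin 3)) (4 * ρ) ⊆ Ω' := fun w hw =>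
    by simpa using hcyl w.1 (mem_prod.1 hw).1 w.2 (mem_prod.1 hw).2
  -- pointwise bounds on the cylinder: `|v| ≤ 2Cu`, `|∇v| ≤ 2K'`
  have hvb : ∀ s ∈ Ioo 0 (L * κ), ∀ y ∈ ball (0 : EuclideanSpace ℝ (Fin 3)) (4 * ρ), ‖v s y‖ ≤ 2 * Cu := by
    intro s hs y hy
    obtain ⟨h1, h2, h3, -⟩ := hwin s hs
    have hcy : c • y ∈ ball (0 : EuclideanSpace ℝ (Fin 3)) 1 := by
      have := hcyl s hs y hy
      rw [hΩ'_def, mem_preimage, stAffine_apply] at this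
      simpa using (mem_prod.1 this).2
    have hsq : c / 2 ≤ Real.sqrt (-(ts + c ^ 2 * s)) :=
      (Real.le_sqrt (by positivity) (by nlinarith [h3, sq_nonneg c])).2 (by nlinarith [h3, sq_nonneg c])
    have hI' := hI (ts + c ^ 2 * s) ⟨h1.le, h2⟩ (c • y) hcy
    rw [hv_apply, norm_smul, Real.norm_of_nonneg hc.le]
    have hden : c / 2 ≤ Real.sqrt (-(ts + c ^ 2 * s)) + ‖c • y‖ := by linarith [norm_nonneg (c • y)]
    have hCu0 : 0 ≤ Cu := hCu.le
    calc c * ‖u (ts + c ^ 2 * s) (c • y)‖ ≤ c * (Cu / (Real.sqrt (-(ts + c ^ 2 * s)) + ‖c • y‖)) :=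
          mul_le_mul_of_nonneg_left hI' hc.le
      _ ≤ c * (Cu / (c / 2)) := by
          gcongr
      _ = 2 * Cu := by field_simp
  have hgradb : ∀ s ∈ Ioo 0 (L * κ), ∀ y ∈ ball (0 : EuclideanSpace ℝ (Fin 3)) (4 * ρ),
      ‖fderiv ℝ (v s) y‖ ≤ 2 * K' := by
    intro s hs y hy
    obtain ⟨h1, h2, h3, h4⟩ := hwin s hs
    have hev : v s = fun y => c • u (ts + c ^ 2 * s) (c • y) := funext (hv_apply s)
    rw [hev, fderiv_smul_comp_smul, norm_smul, Real.norm_of_nonneg (sq_nonneg c)]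
    -- envelope validity: `‖c y‖ + √(−t) ≤ c₁`
    have hsqrt_le : Real.sqrt (-(ts + c ^ 2 * s)) ≤ 2 * c := by
      rw [show 2 * c = Real.sqrt ((2 * c) ^ 2) by rw [Real.sqrt_sq (by positivity)]]
      exact Real.sqrt_le_sqrt (by nlinarith)
    have hcy : ‖c • y‖ ≤ 4 * ρ * c := by
      rw [norm_smul, Real.norm_of_nonneg hc.le]; rw [mem_ball_zero_iff] at hy; nlinarith
    have hscale : ‖c • y‖ + Real.sqrt (-(ts + c ^ 2 * s)) ≤ c₁ := by
      have : (4 * ρ + 2) * c < c₁ := by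
        have := mul_lt_mul_of_pos_left hc_c₁ (by positivity : (0:ℝ) < 4 * ρ + 2)
        rwa [mul_div_cancel₀ _ (by positivity)] at this
      linarith
    have hBu_u : ∫⁻ w in Ioo (-1 : ℝ) 0 ×ˢ ball (0 : EuclideanSpace ℝ (Fin 3)) 1,
        ‖u w.1 w.2‖ₑ ^ (3 : ℕ) ≤ Bu := by
      refine le_trans (le_of_eq (lintegral_congr fun w => ?_)) (lintegral_typeI_cube_le hI)
      rw [← ofReal_norm, ENNReal.ofReal_pow (norm_nonneg _)]
    have hG := Hgrad u p hreg hI hBu_u (HBp u p hreg hI hPr) (ts + c ^ 2 * s) ⟨h1, h2⟩ (c • y) hscale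
    have hden : c ^ 2 / 2 ≤ (‖c • y‖ + Real.sqrt (-(ts + c ^ 2 * s))) ^ 2 := by
      have hsq : Real.sqrt (-(ts + c ^ 2 * s)) ^ 2 = -(ts + c ^ 2 * s) := Real.sq_sqrt (by linarith)
      nlinarith [norm_nonneg (c • y), Real.sqrt_nonneg (-(ts + c ^ 2 * s))]
    calc c ^ 2 * ‖fderiv ℝ (u (ts + c ^ 2 * s)) (c • y)‖
        ≤ c ^ 2 * (K' / (‖c • y‖ + Real.sqrt (-(ts + c ^ 2 * s))) ^ 2) := mul_le_mul_of_nonneg_left hG (sq_nonneg c)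
      _ ≤ c ^ 2 * (K' / (c ^ 2 / 2)) := by gcongr
      _ = 2 * K' := by field_simp
  -- the four structural hypotheses of BGK
  have hsm_v : ContDiffOn ℝ ∞ (uncurry v) (Ioo 0 (L * κ) ×ˢ ball (0 : EuclideanSpace ℝ (Fin 3)) (4 * ρ)) :=
    hsolv.smooth_velocity.mono hcylsub
  have hsm_q : ContDiffOn ℝ ∞ (uncurry q) (Ioo 0 (L * κ) ×ˢ ball (0 : EuclideanSpace ℝ (Fin 3)) (4 * ρ)) :=
    hsolv.smooth_pressure.mono hcylsub
  have heq : ∀ s ∈ Ioo 0 (L * κ), ∀ y ∈ ball (0 : EuclideanSpace ℝ (Fin 3)) (4 * ρ),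
      deriv (fun s' => v s' y) s + convect (v s) (v s) y = Δ (v s) y - gradient (q s) y := by
    intro s hs y hy
    have h := hsolv.momentum_deriv hΩ'open (hcyl s hs y hy)
    rw [h, one_smul]
    simp [stPull_apply]
  have hdiv : ∀ s ∈ Ioo 0 (L * κ), ∀ y ∈ ball (0 : EuclideanSpace ℝ (Fin 3)) (4 * ρ),
      VectorCalculus.divergence (v s) y = 0 := fun s hs y hy => hsolv.divFree s y (hcyl s hs y hy)
  -- the three levels
  have hAlv' : ∀ s ∈ Ioo 0 (L * κ), eLpNorm (v s) (ENNReal.ofReal 4)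
      (volume.restrict (ball (0 : EuclideanSpace ℝ (Fin 3)) (4 * ρ))) ≤ ENNReal.ofReal Alv := fun s hs =>
    eLpNorm_restrict_le_of_forall_norm_le measurableSet_ball hVfin (by norm_num) (hvb s hs)
  have hBlv' : ∀ s ∈ Ioo 0 (L * κ), eLpNorm (q s) (ENNReal.ofReal (4 / 2))
      (volume.restrict (ball (0 : EuclideanSpace ℝ (Fin 3)) (4 * ρ))) ≤ ENNReal.ofReal (Blv ^ 2) := by
    intro s hs
    obtain ⟨h1, h2, h3, h4⟩ := hwin s hs
    set t : ℝ := ts + c ^ 2 * s with ht_def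
    have hnt : 0 < -t := by linarith
    have heq' : q s = fun y => (c ^ 2) • p t (0 + c • y) := by
      funext y; rw [hq_apply, zero_add, smul_eq_mul]
    rw [show ENNReal.ofReal (4 / 2) = 2 by norm_num, heq',
      eLpNorm_smul_comp_space_affine_restrict_ball (p t) (c ^ 2) hc 0 (4 * ρ) 2, finrank_euclideanSpace_fin]
    -- the pressure on `B(0, 4ρc) ⊆ B(0, 8ρ√(−t))`
    have hsub : ball (0 : EuclideanSpace ℝ (Fin 3)) (c * (4 * ρ)) ⊆ ball 0 (8 * ρ * Real.sqrt (-t)) := by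
      apply ball_subset_ball
      have : c ≤ 2 * Real.sqrt (-t) := by
        rw [show 2 * Real.sqrt (-t) = Real.sqrt ((2:ℝ) ^ 2 * (-t)) by
          rw [Real.sqrt_mul (by norm_num), Real.sqrt_sq (by norm_num)]]
        rw [hc_def]; exact Real.sqrt_le_sqrt (by rw [← hc2]; linarith)
      nlinarith
    have hPt := HP' u p hreg hI hPr t ⟨by linarith, h2⟩
    have hmono : eLpNorm (p t) 2 (volume.restrict (ball (0 : EuclideanSpace ℝ (Fin 3)) (c * (4 * ρ)))) ≤
        ENNReal.ofReal (CP * (-t) ^ (-(1 / 4 : ℝ))) :=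
      (eLpNorm_mono_measure _ (Measure.restrict_mono hsub le_rfl)).trans hPt
    have hrp : (-t) ^ (-(1 / 4 : ℝ)) ≤ (c ^ 2 / 2) ^ (-(1 / 4 : ℝ)) :=
      Real.rpow_le_rpow_of_nonpos (by positivity) h3 (by norm_num)
    have hmono' : eLpNorm (p t) 2 (volume.restrict (ball (0 : EuclideanSpace ℝ (Fin 3)) (c * (4 * ρ)))) ≤
        ENNReal.ofReal (CP * (c ^ 2 / 2) ^ (-(1 / 4 : ℝ))) :=
      hmono.trans (ENNReal.ofReal_le_ofReal (mul_le_mul_of_nonneg_left hrp hCP))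
    have e_half : (1 / (2 : ℝ≥0∞)).toReal = (1 / 2 : ℝ) := by
      rw [ENNReal.toReal_div]; norm_num
    rw [Real.enorm_eq_ofReal (sq_nonneg c), e_half,
      ENNReal.ofReal_rpow_of_nonneg (by positivity : (0 : ℝ) ≤ (c ^ 3)⁻¹) (by norm_num : (0 : ℝ) ≤ 1 / 2)]
    calc ENNReal.ofReal (c ^ 2) * (ENNReal.ofReal (((c ^ 3)⁻¹) ^ (1 / 2 : ℝ)) *
          eLpNorm (p t) 2 (volume.restrict (ball (0 : EuclideanSpace ℝ (Fin 3)) (c * (4 * ρ)))))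
        ≤ ENNReal.ofReal (c ^ 2) * (ENNReal.ofReal (((c ^ 3)⁻¹) ^ (1 / 2 : ℝ)) *
          ENNReal.ofReal (CP * (c ^ 2 / 2) ^ (-(1 / 4 : ℝ)))) :=
          by gcongr
      _ = ENNReal.ofReal (CP * (c ^ 2 * ((c ^ 3)⁻¹) ^ (1 / 2 : ℝ) * (c ^ 2 / 2) ^ (-(1 / 4 : ℝ)))) := by
          rw [← ENNReal.ofReal_mul (by positivity), ← ENNReal.ofReal_mul (by positivity)]
          congr 1; ring
      _ ≤ ENNReal.ofReal (Blv ^ 2) := by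
          apply ENNReal.ofReal_le_ofReal
          rw [hBlv_def, Real.sq_sqrt (by positivity : (0 : ℝ) ≤ 2 * CP)]
          calc CP * (c ^ 2 * ((c ^ 3)⁻¹) ^ (1 / 2 : ℝ) * (c ^ 2 / 2) ^ (-(1 / 4 : ℝ))) ≤ CP * 2 :=
                mul_le_mul_of_nonneg_left (zoom_pressure_level_le hc) hCP
            _ = 2 * CP := mul_comm _ _
  have hGlv' : ∫⁻ s in Ioo 0 (L * κ), eLpNorm (fun y => Real.sqrt (frobeniusNormSq (fderiv ℝ (v s) y)))
      (ENNReal.ofReal 4) (volume.restrict (ball (0 : EuclideanSpace ℝ (Fin 3)) (4 * ρ))) ^ (9 : ℝ) ≤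
        ENNReal.ofReal (Glv ^ (9 : ℝ)) := by
    have hpt : ∀ s ∈ Ioo 0 (L * κ), eLpNorm (fun y => Real.sqrt (frobeniusNormSq (fderiv ℝ (v s) y)))
        (ENNReal.ofReal 4) (volume.restrict (ball (0 : EuclideanSpace ℝ (Fin 3)) (4 * ρ))) ≤ ENNReal.ofReal Glv := by
      intro s hs
      refine eLpNorm_restrict_le_of_forall_norm_le measurableSet_ball hVfin (by norm_num) fun y hy => ?_
      rw [Real.norm_of_nonneg (Real.sqrt_nonneg _)]
      have hf := ChaeLocalLeray.frobeniusNormSq_le_three (fderiv ℝ (v s) y)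
      have hg := hgradb s hs y hy
      calc Real.sqrt (frobeniusNormSq (fderiv ℝ (v s) y)) ≤ Real.sqrt (3 * ‖fderiv ℝ (v s) y‖ ^ 2) := Real.sqrt_le_sqrt hf
        _ ≤ Real.sqrt ((2 * ‖fderiv ℝ (v s) y‖) ^ 2) := Real.sqrt_le_sqrt (by nlinarith [norm_nonneg (fderiv ℝ (v s) y)])
        _ = 2 * ‖fderiv ℝ (v s) y‖ := Real.sqrt_sq (by positivity)
        _ ≤ 4 * K' := by linarith
    calc ∫⁻ s in Ioo 0 (L * κ), eLpNorm (fun y => Real.sqrt (frobeniusNormSq (fderiv ℝ (v s) y)))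
          (ENNReal.ofReal 4) (volume.restrict (ball (0 : EuclideanSpace ℝ (Fin 3)) (4 * ρ))) ^ (9 : ℝ)
        ≤ ∫⁻ _s in Ioo 0 (L * κ), ENNReal.ofReal Glv ^ (9 : ℝ) :=
          setLIntegral_mono' measurableSet_Ioo fun s hs => by gcongr; exact hpt s hs
      _ = ENNReal.ofReal Glv ^ (9 : ℝ) * volume (Ioo 0 (L * κ)) := setLIntegral_const _ _
      _ ≤ ENNReal.ofReal Glv ^ (9 : ℝ) * 1 := by
          gcongr
          rw [Real.volume_Ioo]
          exact ENNReal.ofReal_le_one.2 (by linarith)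
      _ = ENNReal.ofReal (Glv ^ (9 : ℝ)) := by
          rw [mul_one, ENNReal.ofReal_rpow_of_nonneg hGlv (by norm_num)]
  -- the window condition at the elapsed time `κ`
  have hwindow : κ ∈ Ioo 0 (C⁻¹ * min (min (L * κ) (ρ ^ 2))
      ((4 : ℝ) ^ 2 * (C * (Alv + Blv + (L * κ) ^ ((9 - 2) / (2 * 9) : ℝ) * Glv)) ^ (2 * 4 / (4 - 3) : ℝ))⁻¹) := by
    refine ⟨hκ, ?_⟩
    have hX' : X ≤ ((4 : ℝ) ^ 2 * (C * (Alv + Blv + (L * κ) ^ ((9 - 2) / (2 * 9) : ℝ) * Glv)) ^ (2 * 4 / (4 - 3) : ℝ))⁻¹ := by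
      rw [hX_def]
      have hle : Alv + Blv + (L * κ) ^ ((9 - 2) / (2 * 9) : ℝ) * Glv ≤ Mbar := by
        rw [hMbar_def]
        have : (L * κ) ^ ((9 - 2) / (2 * 9) : ℝ) * Glv ≤ 1 * Glv :=
          mul_le_mul_of_nonneg_right (Real.rpow_le_one (by positivity) (by linarith) (by norm_num)) hGlv
        linarith
      have hpos : 0 < (4 : ℝ) ^ 2 * (C * (Alv + Blv + (L * κ) ^ ((9 - 2) / (2 * 9) : ℝ) * Glv)) ^ (2 * 4 / (4 - 3) : ℝ) := by
        have : 0 < Alv + Blv + (L * κ) ^ ((9 - 2) / (2 * 9) : ℝ) * Glv := by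
          have : 0 ≤ (L * κ) ^ ((9 - 2) / (2 * 9) : ℝ) * Glv := by positivity
          have hA0 : 0 < Alv := by rw [hAlv_def]; exact mul_pos (Real.rpow_pos_of_pos hV0 _) (by positivity)
          linarith
        positivity
      refine inv_anti₀ hpos ?_
      gcongr
    have h1 : C * κ < L * κ := mul_lt_mul_of_pos_right (by rw [hL_def]; linarith) hκ
    have h2 : C * κ < ρ ^ 2 := by
      have : C * (C⁻¹ * ρ ^ 2 / 2) = ρ ^ 2 / 2 := by field_simp
      nlinarith [mul_le_mul_of_nonneg_left hκρ hC.le, sq_nonneg ρ, hρ]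
    have h3 : C * κ < ((4 : ℝ) ^ 2 * (C * (Alv + Blv + (L * κ) ^ ((9 - 2) / (2 * 9) : ℝ) * Glv)) ^ (2 * 4 / (4 - 3) : ℝ))⁻¹ := by
      have : C * (C⁻¹ * X / 2) = X / 2 := by field_simp
      nlinarith [mul_le_mul_of_nonneg_left hκX hC.le, hX', hX]
    have hmin : C * κ < min (min (L * κ) (ρ ^ 2))
        ((4 : ℝ) ^ 2 * (C * (Alv + Blv + (L * κ) ^ ((9 - 2) / (2 * 9) : ℝ) * Glv)) ^ (2 * 4 / (4 - 3) : ℝ))⁻¹ :=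
      lt_min (lt_min h1 h2) h3
    calc κ = C⁻¹ * (C * κ) := by field_simp
      _ < _ := mul_lt_mul_of_pos_left hmin (inv_pos.2 hC)
  -- BGK
  obtain ⟨U, hU, hUb, hUv⟩ := hBGK 0 hρ (mul_pos hL hκ) (by norm_num : (3 : ℝ) < 4)
    (by norm_num : (2 * 4 / (4 - 3) : ℝ) < 9) hsm_v hsm_q heq hdiv hAlv hBlv hGlv hAlv' hBlv' hGlv' κ hwindow
  refine ⟨U, hU, hUb, fun y hy => ?_⟩
  rw [hUv y hy, hv_apply]
  congr 1
  have ht : ts + c ^ 2 * κ = tb := by rw [hts_def, hc2]; ring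
  rw [ht]
  simp only [physWindowField, zero_sub, zero_add, hc_def]

/-- **K1ω `VortexDefectTubeBound` modulo the scaled slice pressure bound** (T3 ∘ T4). -/
theorem vortexDefectTubeBound_of_scaledSlicePressure
    (hP : ∀ Cu : ℝ, 0 < Cu → ∀ R : ℝ, 0 < R → ∃ CP : ℝ, 0 ≤ CP ∧ ∀ Cp : ℝ, 0 < Cp → ∃ TP : ℝ, 0 < TP ∧
      ∀ (u : ℝ → EuclideanSpace ℝ (Fin 3) → EuclideanSpace ℝ (Fin 3)) (p : ℝ → EuclideanSpace ℝ (Fin 3) → ℝ),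
        IsClassicalNSSolutionOnRegion
          (Ico (-1 : ℝ) 0 ×ˢ ball (0 : EuclideanSpace ℝ (Fin 3)) 1) 1 0 u p →
        (∀ t ∈ Ico (-1 : ℝ) 0, ∀ x ∈ ball (0 : EuclideanSpace ℝ (Fin 3)) 1,
          ‖u t x‖ ≤ Cu / (Real.sqrt (-t) + ‖x‖)) →
        (∀ t ∈ Ico (-1 : ℝ) 0, ∀ x : EuclideanSpace ℝ (Fin 3), 1 / 2 < ‖x‖ → ‖x‖ < 3 / 4 → |p t x| ≤ Cp) →
        ∀ t ∈ Ioo (-TP) 0,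
          eLpNorm (p t) 2 (volume.restrict (ball (0 : EuclideanSpace ℝ (Fin 3)) (R * Real.sqrt (-t)))) ≤
            ENNReal.ofReal (CP * (-t) ^ (-(1 / 4 : ℝ)))) :
    VortexDefectTubeBound :=
  vortexDefectTubeBound_of_windowExtension (windowExtension_of_scaledSlicePressure hP)

end Summit.NavierStokesRegularity.NavierStokesRegularity.Theorems.ScalingDefectPeepholeDoor

end
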